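import Mathlib
import HarnessLib
import HarnessLib.Audit
import Summits.ValiantsHypothesis.ValiantsHypothesis.Theorems.SymmetryDialAffinePebbleThree
import Summits.ValiantsHypothesis.ValiantsHypothesis.Theorems.SymmetryDialTranslationOrbits

/-!
# SymmetryDial — Walsh–Hadamard API on `𝔽₂^d`

Route `SymmetryDial` (workshop `decomp-valiant`, lens 1, gen 8), item 23711 (P′ = `AffinePebblePairs`).
The census instrument and the paper lemmas of the lineage (NODE-g6 (δ′), NODE-g7/g8, census g10 (B))
speak the language of WALSH COEFFICIENTS of Boolean functions `f : 𝔽₂^d → {0,1}`; the tree so far only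
has the hyperplane-section counts `kerCount` (`Theorems/SymmetryDialAffinePebbleThree.lean`).  This file
supplies the reusable kernel API and ties it to `kerCount`:

* §1 the additive characters `chi ξ x = (−1)^{ξ·x}` of `𝔽₂^d` (`V d = Fin d → Fin 2`, pairing `pair`;
  the `𝔽₂`/pairing helpers are reused from `Theorems/SymmetryDialTranslationOrbits.lean`):
  multiplicativity `chi_add`, symmetry, and ORTHOGONALITY `sum_chi` / `sum_chi_left`
  (`Σ_x (−1)^{ξ·x} = [ξ = 0]·2^d`);
* §2 the Walsh transform `walsh f ξ = Σ_x (−1)^{f x + ξ·x}`, the weight `wt f`, and the three identities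
  every counting argument of the lineage uses: `walsh_zero` (`W_f(0) = 2^d − 2·wt f`), `sum_walsh`
  (`Σ_ξ W_f(ξ) = 2^d·(−1)^{f 0}`, census (c3)), PARSEVAL `sum_walsh_sq` (`Σ_ξ W_f(ξ)² = 4^d`), and the
  dictionary `walsh_eq_kerCount` (`W_f(ξ) = [ξ=0]·2^d + 2·wt f − 4·kerCount f ξ`) which makes the certified
  `C³` filter `kerCount_of_pebbleEquiv_three` a statement about Walsh spectra (`wt_eq_of_pebbleEquiv_three`);
* §3 Walsh INVERSION `sum_walsh_chi` (`Σ_ξ W_f(ξ)χ_ξ(x) = 2^d(−1)^{f x}`) and the WIENER–KHINCHIN identity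
  `sum_walsh_sq_chi` (`Σ_ξ W_f(ξ)²χ_ξ(v) = 2^d·Σ_x (−1)^{f x + f(x+v)}`).
The bent-function consequences (weight / hyperplane identities, vanishing autocorrelation, duality) and
the typed targets (B) `BentCThreeBlind`, (I′) `CFourDecidesGLOnBent` live in the companion file
`Theorems/SymmetryDialBent.lean`.

Nothing here bears on VP ≠ VNP (LADDER-Valiant rung 0); it is instrument-side infrastructure for P′.
References: MacWilliams–Sloane ch. 14 (bent functions, Walsh transform); Rothaus 1976; Dillon 1974;
NODE-g8 §5(a) of the workshop lineage (kernel plan for (B)).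
-/

namespace Summit.ValiantsHypothesis.ValiantsHypothesis.Theorems.SymmetryDialWalsh

open Finset
open SymmetryDialAffinePebble (V pair AffinePebbleEquiv affinePebbleEquiv_refl affinePebbleEquiv_mono)
open SymmetryDialAffinePebbleThree (grpMat kerCount incCount incCount_zero incCount_grpMat
  kerCount_of_pebbleEquiv_three card_ones_eq_of_pebbleEquiv_three)
open SymmetryDialPerCongruence (two_nsmul_eq_zero)
open SymmetryDialTranslationOrbits (fin2_ne_zero_iff fin2_add_self pair_add pair_zero_left
  pair_single exists_pair_eq_one card_V)

variable {d : ℕ}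

/-! ### 1. Arithmetic in `𝔽₂^d` and the additive characters -/

/-- `x + y = 0 ↔ y = x` in `𝔽₂^d`. -/
theorem add_eq_zero_iff (x y : V d) : x + y = 0 ↔ y = x := by
  constructor
  · intro h
    calc y = (x + x) + y := by rw [two_nsmul_eq_zero, zero_add]
      _ = x + (x + y) := add_assoc _ _ _
      _ = x := by rw [h, add_zero]
  · rintro rfl; exact two_nsmul_eq_zero _

/-- The pairing is symmetric. -/
theorem pair_comm (ξ x : V d) : pair ξ x = pair x ξ := by
  unfold pair
  exact sum_congr rfl fun i _ => mul_comm _ _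

/-- The additive character `χ_ξ(x) = (−1)^{ξ·x}` as an integer. -/
def chi (ξ x : V d) : ℤ := if pair ξ x = 1 then -1 else 1

/-- The sign of a sum in `𝔽₂` is the product of the signs. -/
theorem fin2_chi_add (a b : Fin 2) :
    (if a + b = 1 then (-1 : ℤ) else 1) = (if a = 1 then (-1 : ℤ) else 1) * (if b = 1 then -1 else 1) := by
  revert a b; decide

/-- Multiplicativity: `χ_ξ(x + y) = χ_ξ(x)·χ_ξ(y)`. -/
theorem chi_add (ξ x y : V d) : chi ξ (x + y) = chi ξ x * chi ξ y := by
  unfold chi; rw [pair_add]; exact fin2_chi_add _ _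

/-- Symmetry: `χ_ξ(x) = χ_x(ξ)`. -/
theorem chi_comm (ξ x : V d) : chi ξ x = chi x ξ := by
  unfold chi; rw [pair_comm]

/-- The trivial character: `χ_0 = 1`. -/
theorem chi_zero_left (x : V d) : chi 0 x = 1 := by
  unfold chi; rw [pair_zero_left]; decide

/-- `χ_ξ(x)² = 1` (product form). -/
theorem chi_mul_self (ξ x : V d) : chi ξ x * chi ξ x = 1 := by
  unfold chi; split_ifs <;> norm_num

/-- `χ_ξ(x)² = 1`. -/
theorem chi_sq (ξ x : V d) : chi ξ x ^ 2 = 1 := by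
  rw [sq, chi_mul_self]

/-- `χ_ξ(x) = 2·[ξ·x = 0] − 1`. -/
theorem chi_eq_indicator (ξ x : V d) : chi ξ x = 2 * (if pair ξ x = 0 then 1 else 0) - 1 := by
  unfold chi
  by_cases h : pair ξ x = 0
  · rw [if_pos h, h]; decide
  · rw [if_neg h, if_pos (fin2_ne_zero_iff.1 h)]; norm_num

/-- **Orthogonality of characters**: `Σ_x (−1)^{ξ·x} = [ξ = 0]·2^d`. -/
theorem sum_chi (ξ : V d) : ∑ x, chi ξ x = if ξ = 0 then (2 : ℤ) ^ d else 0 := by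
  split_ifs with h
  · subst h
    simp [chi_zero_left]
  · obtain ⟨e, hu⟩ := exists_pair_eq_one h
    have he : chi ξ e = -1 := by
      unfold chi; rw [if_pos hu]
    have hS : ∑ x, chi ξ (x + e) = ∑ x, chi ξ x :=
      Fintype.sum_equiv (Equiv.addRight e) (fun x => chi ξ (x + e)) (chi ξ) fun _ => rfl
    have h2 : ∑ x, chi ξ (x + e) = -∑ x, chi ξ x := by
      simp_rw [chi_add, he, mul_neg, mul_one, sum_neg_distrib]
    linarith

/-- Orthogonality in the dual variable: `Σ_ξ (−1)^{ξ·x} = [x = 0]·2^d`. -/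
theorem sum_chi_left (x : V d) : ∑ ξ, chi ξ x = if x = 0 then (2 : ℤ) ^ d else 0 := by
  simp_rw [chi_comm _ x]; exact sum_chi x

/-! ### 2. The Walsh transform -/

/-- The sign function `(−1)^{f x}`. -/
def sgn (f : V d → Bool) (x : V d) : ℤ := if f x = true then -1 else 1

/-- The Walsh–Hadamard coefficient `W_f(ξ) = Σ_x (−1)^{f x + ξ·x}`. -/
def walsh (f : V d → Bool) (ξ : V d) : ℤ := ∑ x, sgn f x * chi ξ x

/-- The Hamming weight `wt f = #{x : f x = 1}`. -/
def wt (f : V d → Bool) : ℕ := ((univ : Finset (V d)).filter fun x => f x = true).card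

/-- `(−1)^{f x}` squares to `1`. -/
theorem sgn_mul_self (f : V d → Bool) (x : V d) : sgn f x * sgn f x = 1 := by
  unfold sgn; split_ifs <;> norm_num

/-- `(−1)^{f x} = 1 − 2·[f x = 1]`. -/
theorem sgn_eq_indicator (f : V d → Bool) (x : V d) :
    sgn f x = 1 - 2 * (if f x = true then 1 else 0) := by
  unfold sgn; split_ifs <;> norm_num

/-- `Σ_x (−1)^{f x} = 2^d − 2·wt f`. -/
theorem sum_sgn (f : V d → Bool) : ∑ x, sgn f x = (2 : ℤ) ^ d - 2 * (wt f : ℤ) := by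
  simp_rw [sgn_eq_indicator, sum_sub_distrib, ← mul_sum]
  rw [sum_const, card_univ, card_V, sum_boole]
  simp [wt]

/-- `W_f(0) = 2^d − 2·wt f`. -/
theorem walsh_zero (f : V d → Bool) : walsh f 0 = (2 : ℤ) ^ d - 2 * (wt f : ℤ) := by
  unfold walsh
  simp_rw [chi_zero_left, mul_one]
  exact sum_sgn f

/-- **Inversion at the origin** (census (c3)): `Σ_ξ W_f(ξ) = 2^d · (−1)^{f 0}`. -/
theorem sum_walsh (f : V d → Bool) : ∑ ξ, walsh f ξ = (2 : ℤ) ^ d * sgn f 0 := by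
  unfold walsh
  rw [sum_comm]
  have h : ∀ x : V d, ∑ ξ : V d, sgn f x * chi ξ x = if x = 0 then sgn f x * 2 ^ d else 0 := by
    intro x
    rw [← mul_sum, sum_chi_left]
    split_ifs <;> simp
  simp_rw [h]
  rw [sum_ite_eq' univ (0 : V d)]
  simp [mul_comm]

/-- **Parseval**: `Σ_ξ W_f(ξ)² = 2^d · 2^d`. -/
theorem sum_walsh_sq (f : V d → Bool) : ∑ ξ, walsh f ξ ^ 2 = (2 : ℤ) ^ d * 2 ^ d := by
  unfold walsh
  have step1 : ∀ ξ : V d, (∑ x, sgn f x * chi ξ x) ^ 2 =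
      ∑ x, ∑ y, sgn f x * sgn f y * chi ξ (x + y) := by
    intro ξ
    rw [sq, sum_mul_sum]
    refine sum_congr rfl fun x _ => sum_congr rfl fun y _ => ?_
    rw [chi_add]; ring
  simp_rw [step1]
  rw [sum_comm]
  have step2 : ∀ x : V d, ∑ ξ : V d, ∑ y, sgn f x * sgn f y * chi ξ (x + y) =
      sgn f x * sgn f x * 2 ^ d := by
    intro x
    rw [sum_comm]
    have : ∀ y : V d, ∑ ξ : V d, sgn f x * sgn f y * chi ξ (x + y) =
        if y = x then sgn f x * sgn f y * 2 ^ d else 0 := by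
      intro y
      rw [← mul_sum, sum_chi_left]
      by_cases hy : y = x
      · subst hy; simp [two_nsmul_eq_zero]
      · have hne : x + y ≠ 0 := fun h0 => hy ((add_eq_zero_iff x y).1 h0)
        simp [hy, hne]
    simp_rw [this]
    rw [sum_ite_eq' univ x]
    simp
  simp_rw [step2, sgn_mul_self, one_mul]
  rw [sum_const, card_univ, card_V]
  simp

/-- `Σ_{f x = 1} χ_ξ(x) = 2·kerCount f ξ − wt f`. -/
theorem sum_support_chi (f : V d → Bool) (ξ : V d) :
    ∑ x ∈ univ.filter (fun x => f x = true), chi ξ x = 2 * (kerCount f ξ : ℤ) - (wt f : ℤ) := by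
  simp_rw [chi_eq_indicator, sum_sub_distrib, ← mul_sum]
  rw [sum_boole, sum_const, filter_filter]
  simp [kerCount, wt]

/-- **Dictionary** with the tree's hyperplane-section counts:
`W_f(ξ) = [ξ = 0]·2^d + 2·wt f − 4·kerCount f ξ`. -/
theorem walsh_eq_kerCount (f : V d → Bool) (ξ : V d) :
    walsh f ξ = (if ξ = 0 then (2 : ℤ) ^ d else 0) + 2 * (wt f : ℤ) - 4 * (kerCount f ξ : ℤ) := by
  unfold walsh
  have h1 : ∀ x, sgn f x * chi ξ x = chi ξ x - 2 * (if f x = true then chi ξ x else 0) := by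
    intro x; unfold sgn; split_ifs <;> ring
  simp_rw [h1, sum_sub_distrib, ← mul_sum]
  rw [sum_chi, ← sum_filter, sum_support_chi]
  ring

/-- `kerCount f 0 = wt f`. -/
theorem kerCount_zero (f : V d → Bool) : kerCount f 0 = wt f := by
  unfold kerCount wt
  congr 1
  exact filter_congr fun v _ => by simp [pair_zero_left]

/-- The number of ones of a group matrix is `2^d · wt f`. -/
theorem card_ones_grpMat (f : V d → Bool) :
    ((univ : Finset (V d × V d)).filter fun xy => grpMat f xy = true).card = 2 ^ d * wt f := by
  rw [← incCount_zero, incCount_grpMat, card_V, kerCount_zero]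

/-- **Three pebble pairs see the weight** of a group matrix's Boolean function. -/
theorem wt_eq_of_pebbleEquiv_three (f g : V d → Bool)
    (h : AffinePebbleEquiv 3 d (grpMat f) (grpMat g)) : wt f = wt g := by
  have := card_ones_eq_of_pebbleEquiv_three _ _ h
  rw [card_ones_grpMat, card_ones_grpMat] at this
  exact Nat.eq_of_mul_eq_mul_left (by positivity) this

/-- **Three pebble pairs see the Walsh spectrum off the origin, up to a bijection of the duals**:
the certified census filter in Walsh currency. -/
theorem walsh_of_pebbleEquiv_three (f g : V d → Bool)
    (h : AffinePebbleEquiv 3 d (grpMat f) (grpMat g)) :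
    ∃ η : V d ≃ V d, ∀ ξ : V d,
      walsh f ξ - (if ξ = 0 then (2 : ℤ) ^ d else 0) =
        walsh g (η ξ) - (if η ξ = 0 then (2 : ℤ) ^ d else 0) := by
  obtain ⟨η, hη⟩ := kerCount_of_pebbleEquiv_three f g h
  refine ⟨η, fun ξ => ?_⟩
  rw [walsh_eq_kerCount, walsh_eq_kerCount, hη ξ, wt_eq_of_pebbleEquiv_three f g h]
  ring

/-! ### 3. Walsh inversion and the Wiener–Khinchin identity -/

/-- **Walsh inversion**: `Σ_ξ W_f(ξ)·χ_ξ(x) = 2^d·(−1)^{f x}`. -/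
theorem sum_walsh_chi (f : V d → Bool) (x : V d) : ∑ ξ, walsh f ξ * chi ξ x = (2 : ℤ) ^ d * sgn f x := by
  unfold walsh
  have h1 : ∀ ξ : V d, (∑ y, sgn f y * chi ξ y) * chi ξ x = ∑ y, sgn f y * chi ξ (y + x) := by
    intro ξ
    rw [sum_mul]
    exact sum_congr rfl fun y _ => by rw [chi_add]; ring
  simp_rw [h1]
  rw [sum_comm]
  have h2 : ∀ y : V d, ∑ ξ : V d, sgn f y * chi ξ (y + x) = if y = x then sgn f y * 2 ^ d else 0 := by
    intro y
    rw [← mul_sum, sum_chi_left]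
    by_cases hy : y = x
    · subst hy; simp [two_nsmul_eq_zero]
    · have hne : y + x ≠ 0 := fun h0 => hy ((add_eq_zero_iff y x).1 h0).symm
      simp [hy, hne]
  simp_rw [h2]
  rw [sum_ite_eq' univ x]
  simp [mul_comm]

/-- **Wiener–Khinchin**: `Σ_ξ W_f(ξ)²·χ_ξ(v) = 2^d · Σ_x (−1)^{f x + f(x+v)}` (the autocorrelation). -/
theorem sum_walsh_sq_chi (f : V d → Bool) (v : V d) :
    ∑ ξ, walsh f ξ ^ 2 * chi ξ v = (2 : ℤ) ^ d * ∑ x, sgn f x * sgn f (x + v) := by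
  unfold walsh
  have step1 : ∀ ξ : V d, (∑ x, sgn f x * chi ξ x) ^ 2 * chi ξ v =
      ∑ x, ∑ y, sgn f x * sgn f y * chi ξ (x + y + v) := by
    intro ξ
    rw [sq, sum_mul_sum, sum_mul]
    refine sum_congr rfl fun x _ => ?_
    rw [sum_mul]
    refine sum_congr rfl fun y _ => ?_
    rw [chi_add, chi_add]; ring
  simp_rw [step1]
  rw [sum_comm]
  have step2 : ∀ x : V d, ∑ ξ : V d, ∑ y, sgn f x * sgn f y * chi ξ (x + y + v) =
      2 ^ d * (sgn f x * sgn f (x + v)) := by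
    intro x
    rw [sum_comm]
    have : ∀ y : V d, ∑ ξ : V d, sgn f x * sgn f y * chi ξ (x + y + v) =
        if y = x + v then sgn f x * sgn f y * 2 ^ d else 0 := by
      intro y
      rw [← mul_sum, sum_chi_left]
      by_cases hy : y = x + v
      · subst hy
        have h0 : x + (x + v) + v = 0 := by
          rw [← add_assoc, two_nsmul_eq_zero, zero_add, two_nsmul_eq_zero]
        simp [h0]
      · have hne : x + y + v ≠ 0 := by
          intro h0
          apply hy
          have h3 : (x + v) + y = 0 := by rw [← h0]; abel
          exact (add_eq_zero_iff (x + v) y).1 h3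
        simp [hy, hne]
    simp_rw [this]
    rw [sum_ite_eq' univ (x + v)]
    simp [mul_comm]
  simp_rw [step2]
  rw [← mul_sum]

end Summit.ValiantsHypothesis.ValiantsHypothesis.Theorems.SymmetryDialWalsh
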